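import Summits.Parity.BatemanHorn.Theorems.LSDRealSegment.Negative.LinearRung

/-!
# `LSDRealSegment` — the pole of `F(1,·)` at `2` and the SHARP holomorphy radius

Support for crux `stmt-Parity-9770` (`Summit.Parity.BatemanHorn.Theses.SelbergDelangeRigidity.LSDRealSegment`), standing
disprover cycle 2; sequel of `Negative/LinearRung.lean` (holomorphy of `F(1,·)`, the crux at `f = X`, rigidity).

* `re_selbergDelangeOmegaF_ge` — for real `1 ≤ y < 2`: `Re F(1,y) ≥ ¼ (1 - y/2)⁻¹` (Bernoulli `(1 - 1/p)^y ≥ 1 - y/p`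
  makes every odd Euler factor real `≥ 1`; the `p = 2` factor is `(1 - y/2)⁻¹ 2^{-y} ≥ ¼(1 - y/2)⁻¹`). So `F(1,y) → +∞`
  as `y → 2⁻`: the pole of `(1 - z/2)⁻¹` ("the restriction to `R < 2` is necessary because of the prime `p = 2`",
  Montgomery–Vaughan p. 179).
* `not_lsdRealSegment_ball` — REFUTED STRENGTHENING: the crux with `Metric.ball 0 2` replaced by `Metric.ball 0 R`, any
  `R > 2` (segment `(5/4, 7/4)` and pin unchanged), is FALSE: witness `f = X`, whose witness `Λ` must be `F(1,·)` on
  `|z| < 2` (rigidity) and is therefore unbounded near `2`, contradicting continuity at `2 ∈ ball 0 R`. With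
  `Negative/WallAtTwo.lean` / `Negative/WallAtTwoSharp.lean` (the SEGMENT cannot reach `2`) the constant `2` of the crux is
  sharp in both of its occurrences.
-/

open Filter Polynomial Finset
open scoped Topology

namespace Summit.Parity.BatemanHorn.Theorems.LSDRealSegment.Negative

open Literature.NumberTheory.Sieve
open Summit.Parity.BatemanHorn.Theorems.SystemLSDRealSegment.Negative
open ArithmeticFunction (cardFactors)
open Literature.NumberTheory.LFunctions
open Literature.NumberTheory.LFunctions.SelbergDelangeOmega

noncomputable section

/-! ## The pole at `2` and the SHARP holomorphy radius -/

/-- The Euler factor at a real point is a real number: `E_p(1,y) = (1 - y/p)⁻¹ (1 - 1/p)^y`. [folklore] -/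
theorem eulerFactor_one_ofReal (p : Nat.Primes) (y : ℝ) :
    eulerFactor p 1 (y : ℂ) = (((1 - y / p)⁻¹ * (1 - 1 / (p : ℝ)) ^ y : ℝ) : ℂ) := by
  rw [eulerFactor_one]
  have hp : (0 : ℝ) ≤ 1 - 1 / (p : ℝ) := by
    have : (1 : ℝ) ≤ p := by exact_mod_cast p.prop.one_lt.le
    rw [sub_nonneg, div_le_one (by positivity)]
    exact this
  push_cast
  rw [Complex.ofReal_cpow hp]
  push_cast
  rfl

/-- Bernoulli: for real `1 ≤ y < p` the real Euler factor is `≥ 1` (`(1 - 1/p)^y ≥ 1 - y/p`). [folklore] -/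
theorem one_le_realEulerFactor {p : ℕ} (hp : 2 ≤ p) {y : ℝ} (hy1 : 1 ≤ y) (hyp : y < p) :
    1 ≤ (1 - y / p)⁻¹ * (1 - 1 / (p : ℝ)) ^ y := by
  have hp0 : (0 : ℝ) < p := by exact_mod_cast (show 0 < p by omega)
  have hs : (-1 : ℝ) ≤ -1 / p := by
    rw [neg_div, neg_le_neg_iff, div_le_one hp0]
    exact_mod_cast (show 1 ≤ p by omega)
  have hB := one_add_mul_self_le_rpow_one_add hs hy1
  have hB' : 1 - y / p ≤ (1 - 1 / (p : ℝ)) ^ y := by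
    have e1 : (1 : ℝ) + y * (-1 / p) = 1 - y / p := by ring
    have e2 : (1 : ℝ) + -1 / p = 1 - 1 / p := by ring
    rwa [e1, e2] at hB
  have h1 : 0 < 1 - y / p := by rw [sub_pos, div_lt_one hp0]; exact hyp
  calc (1 : ℝ) = (1 - y / p)⁻¹ * (1 - y / p) := (inv_mul_cancel₀ h1.ne').symm
    _ ≤ (1 - y / p)⁻¹ * (1 - 1 / (p : ℝ)) ^ y := by
        have : 0 ≤ (1 - y / p)⁻¹ := inv_nonneg.2 h1.le
        gcongr

/-- **LOWER BOUND AT THE WALL**: for real `1 ≤ y < 2`, `Re F(1,y) ≥ ¼ (1 - y/2)⁻¹` (keep the `p = 2` factor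
`(1 - y/2)⁻¹ 2^{-y} ≥ ¼ (1 - y/2)⁻¹`, all other factors are real `≥ 1`). So `F(1,y) → +∞` as `y → 2⁻`.
[cite: MontgomeryVaughan2007, §7.4 (7.60)] -/
theorem re_selbergDelangeOmegaF_ge {y : ℝ} (hy1 : 1 ≤ y) (hy2 : y < 2) :
    1 / 4 * (1 - y / 2)⁻¹ ≤ (selbergDelangeOmegaF y).re := by
  set r : Nat.Primes → ℝ := fun p => (1 - y / p)⁻¹ * (1 - 1 / (p : ℝ)) ^ y with hr
  have hfac : (fun p : Nat.Primes => eulerFactor p 1 (y : ℂ)) = fun p => ((r p : ℝ) : ℂ) :=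
    funext fun p => eulerFactor_one_ofReal p y
  have hprod : Tendsto (fun s : Finset Nat.Primes => ∏ p ∈ s, ((r p : ℝ) : ℂ)) atTop
      (𝓝 (selbergDelangeOmegaF y)) := by
    have h := hasProd_bigOmegaF (y : ℂ) (s := 1) (by norm_num)
    rw [bigOmegaF_one, hfac] at h
    exact h
  have ht : Tendsto (fun s : Finset Nat.Primes => ∏ p ∈ s, r p) atTop (𝓝 (selbergDelangeOmegaF y).re) := by
    have := (Complex.continuous_re.tendsto _).comp hprod
    refine this.congr fun s => ?_
    simp only [Function.comp_apply]
    rw [← Complex.ofReal_prod, Complex.ofReal_re]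
  set two : Nat.Primes := ⟨2, Nat.prime_two⟩ with htwo
  have hr1 : ∀ p : Nat.Primes, p ≠ two → 1 ≤ r p := by
    intro p hp
    have hp2 : (2 : ℕ) ≤ p := p.prop.two_le
    have hp3 : (3 : ℕ) ≤ p := by
      rcases Nat.lt_or_ge (p : ℕ) 3 with h | h
      · exfalso
        apply hp
        have : (p : ℕ) = 2 := by omega
        exact Subtype.ext this
      · exact h
    have hyp : y < ((p : ℕ) : ℝ) := by
      have : (3 : ℝ) ≤ ((p : ℕ) : ℝ) := by exact_mod_cast hp3
      linarith
    exact one_le_realEulerFactor hp2 hy1 hyp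
  have hr2 : 1 / 4 * (1 - y / 2)⁻¹ ≤ r two := by
    have hpow : (1 / 4 : ℝ) ≤ (1 - 1 / ((2 : ℕ) : ℝ)) ^ y := by
      have e : (1 - 1 / ((2 : ℕ) : ℝ)) = 1 / 2 := by norm_num
      rw [e]
      calc (1 / 4 : ℝ) = (1 / 2) ^ ((2 : ℕ) : ℝ) := by rw [Real.rpow_natCast]; norm_num
        _ ≤ (1 / 2) ^ y := Real.rpow_le_rpow_of_exponent_ge (by norm_num) (by norm_num)
            (by push_cast; linarith)
    have hinv : 0 ≤ (1 - y / ((2 : ℕ) : ℝ))⁻¹ := by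
      rw [inv_nonneg, sub_nonneg, div_le_one (by norm_num)]
      push_cast; linarith
    have e2 : (1 - y / 2)⁻¹ = (1 - y / ((2 : ℕ) : ℝ))⁻¹ := by norm_num
    rw [e2]
    calc 1 / 4 * (1 - y / ((2 : ℕ) : ℝ))⁻¹ = (1 - y / ((2 : ℕ) : ℝ))⁻¹ * (1 / 4) := by ring
      _ ≤ (1 - y / ((2 : ℕ) : ℝ))⁻¹ * (1 - 1 / ((2 : ℕ) : ℝ)) ^ y := by gcongr
      _ = r two := by simp only [hr, htwo]
  refine ge_of_tendsto ht ?_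
  filter_upwards [eventually_ge_atTop ({two} : Finset Nat.Primes)] with s hs
  have hmem : two ∈ s := hs (Finset.mem_singleton_self two)
  rw [← Finset.mul_prod_erase s r hmem]
  have hone : (1 : ℝ) ≤ ∏ p ∈ s.erase two, r p := by
    calc (1 : ℝ) = ∏ _p ∈ s.erase two, (1 : ℝ) := by simp
      _ ≤ ∏ p ∈ s.erase two, r p :=
          Finset.prod_le_prod (fun _ _ => zero_le_one) fun p hp => hr1 p (Finset.ne_of_mem_erase hp)
  have hr2pos : 0 ≤ r two := le_trans (by
    have : 0 ≤ (1 - y / 2)⁻¹ := by rw [inv_nonneg]; linarith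
    positivity) hr2
  calc 1 / 4 * (1 - y / 2)⁻¹ ≤ r two * 1 := by rw [mul_one]; exact hr2
    _ ≤ r two * ∏ p ∈ s.erase two, r p := by gcongr

/-- **THE HOLOMORPHY RADIUS `2` IS SHARP** (refuted strengthening): the crux with `Metric.ball 0 2` replaced by
`Metric.ball 0 R` for ANY `R > 2` (segment `(5/4, 7/4)` and pin `Λ 0 = C(f)` unchanged) is FALSE. Witness `k = 1`,
`f = X`: a witness `Λ` must coincide with Selberg's `F(1,·)` on `|z| < 2` (rigidity, above), `Re F(1,y) ≥ ¼(1 - y/2)⁻¹ → ∞`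
as `y → 2⁻` (the pole of the `p = 2` factor `(1 - z/2)⁻¹`), contradicting the continuity of `Λ` at `2 ∈ ball 0 R`. With
`WallAtTwo`/`WallAtTwoSharp` (`y < b`, `b > 2`, and `y ≤ 2` fail on the `H_x` side) this closes the audit of the constant `2`: it is sharp in BOTH
places it occurs. [cite: MontgomeryVaughan2007, §7.4 (7.60) and p. 179] -/
theorem not_lsdRealSegment_ball {R : ℝ} (hR : 2 < R) :
    ¬ ∀ (k : ℕ) (f : Fin k → ℤ[X]), IsBatemanHornSystem f → ∃ Λ : ℂ → ℂ, DifferentiableOn ℂ Λ (Metric.ball 0 R) ∧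
      Λ 0 = (batemanHornConst f : ℂ) ∧ ∀ y : ℝ, 5 / 4 < y → y < 7 / 4 →
        Filter.Tendsto (fun x : ℕ => (x : ℂ)⁻¹
            * Complex.exp ((k : ℂ) * (1 - (y : ℂ)) * (Real.log (Real.log x) : ℂ)) *
          ∑ n ∈ Finset.range (x + 1), (y : ℂ) ^ (∑ i, cardFactors (((f i).eval (n : ℤ)).toNat))) Filter.atTop
          (nhds (Λ y * Complex.exp (((y : ℂ) - 1) * (Real.log (∏ i, ((f i).natDegree : ℝ)) : ℂ)) *
            (Complex.Gamma y)⁻¹ ^ k)) := by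
  intro h
  obtain ⟨Λ, hΛR, -, hlaw⟩ := h 1 ![X] isBatemanHornSystem_X
  have hΛ : DifferentiableOn ℂ Λ (Metric.ball 0 2) := hΛR.mono (Metric.ball_subset_ball hR.le)
  have heq := eqOn_selbergDelangeOmegaF_of_omegaSegmentLaw_X hΛ fun y hy hy' => by
    simpa [mul_assoc] using hlaw y hy hy'
  have h2mem : (2 : ℂ) ∈ Metric.ball (0 : ℂ) R := by
    rw [Metric.mem_ball, dist_zero_right]
    simpa using hR
  have hcont : ContinuousAt Λ 2 := (hΛR.differentiableAt (Metric.isOpen_ball.mem_nhds h2mem)).continuousAt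
  obtain ⟨δ, hδ, hB⟩ : ∃ δ > 0, ∀ z : ℂ, dist z 2 < δ → ‖Λ z‖ < ‖Λ 2‖ + 1 := by
    obtain ⟨δ, hδ, h⟩ := Metric.continuousAt_iff.1 hcont 1 one_pos
    refine ⟨δ, hδ, fun z hz => ?_⟩
    have h1 : dist (Λ z) (Λ 2) < 1 := h hz
    rw [dist_eq_norm] at h1
    calc ‖Λ z‖ = ‖Λ 2 + (Λ z - Λ 2)‖ := by congr 1; ring
      _ ≤ ‖Λ 2‖ + ‖Λ z - Λ 2‖ := norm_add_le _ _
      _ < ‖Λ 2‖ + 1 := by linarith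
  set B : ℝ := ‖Λ 2‖ + 1 with hBdef
  have hB0 : 0 < B := by positivity
  set t : ℝ := min (δ / 2) (min (1 / 2) (1 / (8 * B))) with ht
  have ht0 : 0 < t := by positivity
  have htδ : t < δ := (min_le_left _ _).trans_lt (half_lt_self hδ)
  have ht2 : t ≤ 1 / 2 := (min_le_right _ _).trans (min_le_left _ _)
  have htB : t ≤ 1 / (8 * B) := (min_le_right _ _).trans (min_le_right _ _)
  set y : ℝ := 2 - t with hy
  have hy1 : 1 ≤ y := by rw [hy]; linarith
  have hy2 : y < 2 := by rw [hy]; linarith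
  have hyball : ((y : ℝ) : ℂ) ∈ Metric.ball (0 : ℂ) 2 := by
    rw [Metric.mem_ball, dist_zero_right, Complex.norm_real, Real.norm_eq_abs, abs_of_nonneg (by linarith)]
    exact hy2
  have hΛy : Λ y = selbergDelangeOmegaF y := heq hyball
  have hlow := re_selbergDelangeOmegaF_ge hy1 hy2
  have hdist : dist ((y : ℝ) : ℂ) 2 < δ := by
    rw [dist_eq_norm, show ((y : ℝ) : ℂ) - 2 = ((y - 2 : ℝ) : ℂ) by push_cast; ring, Complex.norm_real,
      Real.norm_eq_abs, hy, show 2 - t - 2 = -t by ring, abs_neg, abs_of_pos ht0]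
    exact htδ
  have hup : ‖Λ y‖ < B := hB _ hdist
  have hre : (selbergDelangeOmegaF y).re ≤ ‖Λ y‖ := by rw [hΛy]; exact Complex.re_le_norm _
  have hval : 1 / 4 * (1 - y / 2)⁻¹ = 1 / (2 * t) := by
    rw [hy, show 1 - (2 - t) / 2 = t / 2 by ring]
    have ht0' : t ≠ 0 := ht0.ne'
    field_simp
    norm_num
  have h4B : 4 * B ≤ 1 / (2 * t) := by
    have h1 : 2 * t ≤ 1 / (4 * B) := by
      calc 2 * t ≤ 2 * (1 / (8 * B)) := by linarith
        _ = 1 / (4 * B) := by field_simp; ring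
    calc 4 * B = 1 / (1 / (4 * B)) := by field_simp
      _ ≤ 1 / (2 * t) := one_div_le_one_div_of_le (by positivity) h1
  linarith

end

end Summit.Parity.BatemanHorn.Theorems.LSDRealSegment.Negative
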